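import Summits.Ventures.YMGap.RobustBall.LoopActionFiniteRange
import Summits.Ventures.YMGap.RobustBall.ShapeLoopFamily
import HarnessLib

/-!
# Venture YMGap, track ROBUST-BALL (tier 1) — FINITELY MANY LOOP SHAPES, translated everywhere: the plain norm
# `∑_s |c_s| |s|²` controls the tier-1 ball (twice the coupling)

HONEST FRAMING. WHAT THIS IS: a venture file (cell `pub-ymgap`, track Y2 ROBUST-BALL, seat rb-p1), the finite-range reading of
`ShapeLoopFamily.lean` through `LoopActionFiniteRange.lean`: a translation-invariant generalized Wilson action built from FINITELY
MANY nontrivial loop shapes `σ : S → {closed walks at 0}` (`S` a finite type — the format of every "improved" lattice action: Wilson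
plus rectangles, chairs, twisted loops, …) with shape couplings `c₀`. Finitely many shapes give finitely many loops through every
link (`finite_through_shapeLoop`) and a common extent, so the action lies in the TIER-1 ball with the PLAIN norm
`∑_s |c₀ s| · |σ s|²` (`loopNormLE_zero_shapeLoop`), and the tier-1 rows apply: `SU(2)`, `d = 4`, `β_W = 1/8`:
`∑_s |c₀ s| |σ s|² ≤ 0.143` ⇒ unique DLR state with exponential clustering (`su2_finiteShapes_massGapS_1_8`); `β_W = 1/10` for `0.209`;
every `N ≥ 2` at 't Hooft `|β| ≤ 1/64` for `0.11`; `SU(2)` on `ℤ³` at `β_W = 1/5` for `0.123`. WHAT IT IS NOT: strong-coupling lattice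
statements inside the rows' windows; nothing about the continuum limit or the Clay problem.

References: this track's `ShapeLoopFamily.lean`, `LoopActionFiniteRange.lean`, `RowsSU2.lean`, `RowsSUNCells.lean`, `RowsDim3.lean`.
-/

noncomputable section

open MeasureTheory Function Real SimpleGraph
open Literature.Probability.LatticeModels
open Literature.MathematicalPhysics.QuantumLattice
open Literature.MathematicalPhysics.QuantumFieldTheory (walkEdges)

namespace Summit.Ventures.YMGap.RobustBall

variable {d N : ℕ} {S : Type*} {σ : S → (zdGraph d).Walk (0 : Site d) 0} {c₀ : S → ℝ} {R ε : ℝ}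

/-! ### Finitely many shapes: finitely many loops through a link, plain norm -/

/-- A finite shape family has finite edge-set fibres (trivially). -/
theorem finite_fibre_of_finite_shapes [Finite S] (Y : Finset (ZdEdge d)) : {s : S | walkEdges (σ s) = Y}.Finite :=
  Set.toFinite _

/-- **Finitely many loops through every link**: the translates of a shape through `e` are based at `e.1 − y.1` for a link
`y` of the shape with the same direction. -/
theorem finite_through_shapeLoop [Finite S] (σ : S → (zdGraph d).Walk (0 : Site d) 0) (e : ZdEdge d) :
    {i : Site d × S | e ∈ walkEdges (shapeLoop σ i).walk}.Finite := by
  refine (Set.finite_iUnion fun s : S =>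
    ((walkEdges (σ s)).finite_toSet.image fun y : ZdEdge d => ((e.1 - y.1, s) : Site d × S))).subset ?_
  rintro ⟨x, s⟩ hx
  have h := (mem_walkEdges_shapeLoop_iff σ (x, s) e).1 hx
  simp only [Set.mem_iUnion, Set.mem_image, Finset.mem_coe]
  exact ⟨s, (e.1 - x, e.2), h, by simp⟩

/-- **The plain norm of a finite shape family at weight `0`**: `‖c‖₀ ≤ ∑_s |c₀ s| |σ s|²` (`ε` any upper bound; links of each
shape within some extent `R`). -/
theorem loopNormLE_zero_shapeLoop [Fintype S] (hR : ∀ s, ∀ e ∈ walkEdges (σ s), ∀ y ∈ walkEdges (σ s), ‖e.1 - y.1‖ ≤ R)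
    (hε : ∑ s, |c₀ s| * ((σ s).length : ℝ) ^ 2 ≤ ε) : LoopNormLE 0 (shapeLoop σ) (fun i => c₀ i.2) ε := by
  refine loopNormLE_shapeLoop (D₀ := fun _ => R) le_rfl hR (Summable.of_finite) ?_
  rw [tsum_fintype]
  simpa only [zero_mul, exp_zero, mul_one] using hε

/-- **Finite shape families are tier-1 members**: `∑_s |c₀ s| |σ s|² ≤ ε`, nontrivial shapes of extent `≤ R` ⇒
`(loopFamilyAction N (shapeLoop σ) (c₀ ∘ snd), loopSupp (shapeLoop σ)) ∈ MemBallZd (2ε) ε R`. -/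
theorem memBallZd_shapeLoop [Fintype S] (hpos : ∀ s, 0 < (σ s).length)
    (hR : ∀ s, ∀ e ∈ walkEdges (σ s), ∀ y ∈ walkEdges (σ s), ‖e.1 - y.1‖ ≤ R)
    (hε : ∑ s, |c₀ s| * ((σ s).length : ℝ) ^ 2 ≤ ε) :
    MemBallZd (2 * ε) ε R (loopFamilyAction (d := d) N (shapeLoop σ) fun i => c₀ i.2) (loopSupp (shapeLoop σ)) := by
  refine memBallZd_loopFamilyAction (finite_fibre_shapeLoop σ finite_fibre_of_finite_shapes hpos) (finite_through_shapeLoop σ)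
    (fun i e he y hy => ?_) (loopNormLE_zero_shapeLoop hR hε)
  have h := hR i.2 _ ((mem_walkEdges_shapeLoop_iff σ i e).1 he) _ ((mem_walkEdges_shapeLoop_iff σ i y).1 hy)
  simpa [sub_sub_sub_cancel_right] using h

/-- **Mass gap for finite shape families from a tier-1 row.** -/
theorem perturbedMassGapAtS_shapeLoop_of_tier1 [Fintype S] {β : ℝ} (hrow : MassGapOnBallZd d N β (2 * ε) ε R)
    (hpos : ∀ s, 0 < (σ s).length) (hR : ∀ s, ∀ e ∈ walkEdges (σ s), ∀ y ∈ walkEdges (σ s), ‖e.1 - y.1‖ ≤ R)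
    (hε : ∑ s, |c₀ s| * ((σ s).length : ℝ) ^ 2 ≤ ε) :
    PerturbedMassGapAtS d N β (loopFamilyAction (d := d) N (shapeLoop σ) fun i => c₀ i.2) :=
  perturbedMassGapAtS_loopFamilyAction_of_tier1 hrow (finite_fibre_shapeLoop σ finite_fibre_of_finite_shapes hpos)
    (finite_through_shapeLoop σ) (fun i e he y hy => by
      have h := hR i.2 _ ((mem_walkEdges_shapeLoop_iff σ i e).1 he) _ ((mem_walkEdges_shapeLoop_iff σ i y).1 hy)
      simpa [sub_sub_sub_cancel_right] using h) (loopNormLE_zero_shapeLoop hR hε)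

/-! ### Cells -/

section Rows

variable [Fintype S]

/-- **`SU(2)`, `d = 4`, `β_W = 1/8` — ANY FINITE SET OF LOOP SHAPES translated everywhere**: nontrivial shapes, couplings with
`∑_s |c₀ s| · |σ s|² ≤ 0.143` ⇒ the translation-invariant generalized Wilson action has a unique DLR state with exponential clustering
(tier-1 row `su2_rowB_1_8` at the shapes' extent). -/
theorem su2_finiteShapes_massGapS_1_8 {σ : S → (zdGraph 4).Walk (0 : Site 4) 0} (hpos : ∀ s, 0 < (σ s).length)
    (hR : ∀ s, ∀ e ∈ walkEdges (σ s), ∀ y ∈ walkEdges (σ s), ‖e.1 - y.1‖ ≤ R) {c₀ : S → ℝ}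
    (hε : ∑ s, |c₀ s| * ((σ s).length : ℝ) ^ 2 ≤ 143 / 1000) :
    PerturbedMassGapAtS 4 2 ((1 / 8 : ℝ) / 4) (loopFamilyAction (d := 4) 2 (shapeLoop σ) fun i => c₀ i.2) :=
  perturbedMassGapAtS_shapeLoop_of_tier1 (su2_rowB_1_8 R) hpos hR hε

/-- **`SU(2)`, `d = 4`, `β_W = 1/10`**: `∑_s |c₀ s| |σ s|² ≤ 0.209` (tier-1 row `su2_rowB_1_10`). -/
theorem su2_finiteShapes_massGapS_1_10 {σ : S → (zdGraph 4).Walk (0 : Site 4) 0} (hpos : ∀ s, 0 < (σ s).length)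
    (hR : ∀ s, ∀ e ∈ walkEdges (σ s), ∀ y ∈ walkEdges (σ s), ‖e.1 - y.1‖ ≤ R) {c₀ : S → ℝ}
    (hε : ∑ s, |c₀ s| * ((σ s).length : ℝ) ^ 2 ≤ 209 / 1000) :
    PerturbedMassGapAtS 4 2 ((1 / 10 : ℝ) / 4) (loopFamilyAction (d := 4) 2 (shapeLoop σ) fun i => c₀ i.2) :=
  perturbedMassGapAtS_shapeLoop_of_tier1 (su2_rowB_1_10 R) hpos hR hε

/-- **Every `N ≥ 2`, `d = 4`, 't Hooft `|β| ≤ 1/64`**: `∑_s |c₀ s| |σ s|² ≤ 0.11`, `N`-uniformly (p1's tier-1 cell `suN_zdRow4_1_64`). -/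
theorem suN_finiteShapes_massGapS_1_64 {N : ℕ} (hN : 2 ≤ N) {β : ℝ} (hβ : |β| ≤ 1 / 64)
    {σ : S → (zdGraph 4).Walk (0 : Site 4) 0} (hpos : ∀ s, 0 < (σ s).length)
    (hR : ∀ s, ∀ e ∈ walkEdges (σ s), ∀ y ∈ walkEdges (σ s), ‖e.1 - y.1‖ ≤ R) {c₀ : S → ℝ}
    (hε : ∑ s, |c₀ s| * ((σ s).length : ℝ) ^ 2 ≤ 11 / 100) :
    PerturbedMassGapAtS 4 N β (loopFamilyAction (d := 4) N (shapeLoop σ) fun i => c₀ i.2) := by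
  have hrow := RobustBallSUN.suN_zdRow4_1_64 hN hβ R
  have hrow' : MassGapOnBallZd 4 N β (2 * (11 / 100)) (11 / 100) R := by norm_num at hrow ⊢; exact hrow
  exact perturbedMassGapAtS_shapeLoop_of_tier1 hrow' hpos hR hε

/-- **`SU(2)`, `d = 3`, `β_W = 1/5`**: `∑_s |c₀ s| |σ s|² ≤ 0.123` on `ℤ³` (tier-1 row `su2_dim3_row_1_5`). -/
theorem su2_dim3_finiteShapes_massGapS_1_5 {σ : S → (zdGraph 3).Walk (0 : Site 3) 0} (hpos : ∀ s, 0 < (σ s).length)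
    (hR : ∀ s, ∀ e ∈ walkEdges (σ s), ∀ y ∈ walkEdges (σ s), ‖e.1 - y.1‖ ≤ R) {c₀ : S → ℝ}
    (hε : ∑ s, |c₀ s| * ((σ s).length : ℝ) ^ 2 ≤ 123 / 1000) :
    PerturbedMassGapAtS 3 2 ((1 / 5 : ℝ) / 4) (loopFamilyAction (d := 3) 2 (shapeLoop σ) fun i => c₀ i.2) :=
  perturbedMassGapAtS_shapeLoop_of_tier1 (RobustBallDim3.su2_dim3_row_1_5 R) hpos hR hε

end Rows

end Summit.Ventures.YMGap.RobustBall

end
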